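import Literature.NumberTheory.LFunctions.RiemannSiegel
import Literature.NumberTheory.LFunctions.ZetaZeros
import Mathlib.MeasureTheory.Integral.IntervalIntegral.Basic
import Mathlib.Analysis.Real.Pi.Bounds
import HarnessLib

/-!
# RH-CONDITIONAL — Simonič's explicit bounds for `S(t)`, `S₁(t)`, `ζ(½ + it)` and zero gaps under RH («nothing here bears on the truth of RH»)

Topic `Literature/NumberTheory/LFunctions` (RH literature-typing tranche 1, L4 "explicit zero
statistics"). Label: **RH-CONDITIONAL** — every fact below has the shape `RiemannHypothesis → …`
(Mathlib's `RiemannHypothesis`), with the hypothesis explicit; they are published theorems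
("Assume the Riemann Hypothesis. Then …") vendored as NAMED FACTS (`def … : Prop`, D-0014;
nothing is asserted, users take `(h : …)` and feed it RH). Nothing here bears on the truth of RH.

Source: A. Simonič, *On explicit estimates for `S(t)`, `S₁(t)`, and `ζ(1/2 + it)` under the Riemann
Hypothesis*, J. Number Theory **231** (2022) 464–491 (arXiv:2010.13307; Zbl 1489.11124), first typed
from the held arXiv text `[corpus:paper:arxiv-2010.13307 p0004 (Thm. 1, Cors. 1–2), p0011 (Lemma 6,
proofs)]`, which is arXiv **v1** (26 Oct 2020), and re-audited (2026-08-27) against the arXiv **v2**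
TeX source (13 Oct 2021 — the refereed text: its acknowledgements thank "the anonymous referee for
providing many valuable suggestions and corrections"; the journal article appeared online on
16 Jul 2021). **VERSION CAVEAT.** v2 prints three WEAKER constants than v1 — Theorem 1 (iii):
`𝓜(0.5, 6.992, 0.252; t)` (v1: `6.361`); Corollary 1: `|S₁(t)| ≤ 2.491 log t/(log log t)²`
(v1: `2.488`) and `|ζ(½+it)| ≤ exp(0.995 log t/log log t)` (v1: `0.95`) — and is otherwise identical
in every statement typed here (Theorem 1 (i)–(ii) with their thresholds, Corollary 1 for `S`,
Corollary 2, Lemma 6). The refereed statements are `Simonic2022_thm1_zeta_v2`,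
`Simonic2022_cor1_S1_v2`, `Simonic2022_cor1_zeta_v2`. The three v1-constant definitions
`Simonic2022_thm1_zeta`, `Simonic2022_cor1_S1`, `Simonic2022_cor1_zeta` are KEPT (append-only tree)
but re-tagged as claims of the SUPERSEDED preprint v1 [Simonic2020v1]: do not use them as published
facts; each trivially implies its `_v2` form (`Simonic2022_thm1_zeta.imp_v2` etc., proved below),
not conversely. With `𝓜(a, b, c; t) := a + b/((log t)^c log log t)` (eq. (1.10) of the source,
`Literature.NumberTheory.LFunctions.simonicM`):

* `Simonic2022_thm1_S` — **Theorem 1 (i)**: RH ⇒ `|S(t)| ≤ 𝓜(0.759282, 20.1911, 0.285; t) log t/log log t`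
  for `t ≥ 10^2465`;
* `Simonic2022_thm1_S1` — **Theorem 1 (ii)**: RH ⇒ `|S₁(t)| ≤ 𝓜(0.653, 60.12, 0.2705; t) log t/(log log t)²`
  for `t ≥ 10^208`;
* `Simonic2022_thm1_zeta_v2` — **Theorem 1 (iii)** (refereed text): RH ⇒
  `|ζ(½ + it)| ≤ exp(𝓜(0.5, 6.992, 0.252; t) log t/log log t)` for `t ≥ 10^40`
  (`Simonic2022_thm1_zeta`: the superseded v1 constant `6.361`);
* `Simonic2022_cor1_S`, `Simonic2022_cor1_S1_v2`, `Simonic2022_cor1_zeta_v2` — **Corollary 1**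
  (refereed text): RH ⇒ for `t ≥ 2π`, `|S(t)| ≤ 0.96 log t/log log t`,
  `|S₁(t)| ≤ 2.491 log t/(log log t)²`, `|ζ(½ + it)| ≤ exp(0.995 log t/log log t)`
  (`Simonic2022_cor1_S1`, `Simonic2022_cor1_zeta`: the superseded v1 constants `2.488`, `0.95`);
* `Simonic2022_cor2` — **Corollary 2**: RH ⇒ consecutive ordinates `γ' ≥ γ ≥ 10^2465` satisfy
  `γ' − γ ≤ 𝓜(9.55, 253.82, 0.285; γ)/log log γ`; `Simonic2022_cor2_simple`: "in particular
  `γ' − γ ≤ 12.05/log log γ`".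

Context (unconditional, in the tree): `|S(T)| ≤ 0.3083 log T + 3.24` for `T ≥ 30`
(`abs_zetaArgS_le_explicit`, proved) and Hasanalizade–Shen–Wong's `0.1038 log T + …`
(`ZetaArgHSW.lean`); Titchmarsh's inexplicit RH bound `ζ(½+it) ≪ exp(A log t/log log t)`
(`CriticalLineRH.exists_norm_zeta_half_le_exp_of_RH`, proved). The explicit RH-conditional
constants of this file (method: Selberg–Fujii with the parameterised `σ_{x,α}`; `C₀ = 0.543`,
`C₁ = 0.337`, `C₀₀ = 0.373` with explicit `o(1)`-terms) are absent from the tree (searched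
`zetaArgS .* Real.log (Real.log`, `Simonic`, `GoldstonGonek`, `CarneiroChandeeMilinovich`).

## Conventions

* `S(t)` is the tree's `Literature.NumberTheory.LFunctions.zetaArgS` (Backlund's
  `S(T) := N(T) − θ(T)/π − 1`, right-continuous: at an ordinate it is `S(γ + 0)`), whereas the
  source takes the average `(S(γ+0) + S(γ−0))/2` at ordinates. The typed statements
  "`∀ t ≥ t₀, |zetaArgS t| ≤ B(t)`" are EQUIVALENT to the printed ones: off ordinates the two `S`
  agree; at an ordinate `γ`, `S(γ ± 0) = lim S(γ ± ε)` and `B` is continuous, so both one-sided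
  values (hence their average, and the tree's `S(γ+0)`) obey the bound.
* `S₁(t) = ∫₀ᵗ S(u) du` is written `∫ u in (0:ℝ)..t, zetaArgS u` (the convention at the countably
  many ordinates is immaterial).
* "Consecutive ordinates `γ' ≥ γ`" are `zetaOrdinate n ≤ zetaOrdinate (n + 1)` (the tree's
  enumeration with multiplicity, `Literature.NumberTheory.LFunctions.zetaOrdinate`; a repeated
  ordinate gives gap `0`, and two consecutive DISTINCT ordinates are consecutive entries of the
  enumeration at some index, so the two readings of Corollary 2 are equivalent).
* Numerical thresholds `10^2465`, `10^208`, `10^40` are written `(10 : ℝ) ^ 2465` etc.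

Proved here (no new hypotheses): `simonicM_antitoneOn`-type monotonicity
(`simonicM_le_of_le`: `𝓜(a,b,c;t) ≤ 𝓜(a,b,c;t₀)` for `t ≥ t₀ ≥ 16`, `b, c ≥ 0`;
`simonicM_le_simonicM_of_le`: monotone in `b` for `t ≥ 16`), whence the frozen-constant forms
`Simonic2022_thm1_S.le_const` etc.: on `t ≥ t₀` the Theorem-1 bounds hold with the constant
`𝓜(·;t₀)`; and the implications v1 ⇒ v2 (`Simonic2022_thm1_zeta.imp_v2`,
`Simonic2022_cor1_S1.imp_v2`, `Simonic2022_cor1_zeta.imp_v2`). What is deliberately NOT here: the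
intermediate Theorems 2–4 / Corollaries 3–5 of §§2–3 (parameterised bounds in `x, α`), and any
unconditional claim.

## Proved elsewhere in this tree (the corollaries are CONSEQUENCES of Theorem 1)

* `ZetaZeroGapsRHExplicitProofs.lean`: **Lemma 6** RH-free
  (`Literature.NumberTheory.LFunctions.Simonic2022Lemma6.zetaOrdinate_succ_le`, `….printed`,
  `….printed_tree`, `….printed_bpt`); **Corollary 2 and its "12.05" form from Theorem 1 (i)**:
  `Literature.NumberTheory.LFunctions.Simonic2022_cor2_of_thm1_S : Simonic2022_thm1_S → Simonic2022_cor2`,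
  `Literature.NumberTheory.LFunctions.Simonic2022_cor2_simple_of_thm1_S` (kernel interval numerics
  `𝓜(9.55, 253.82, 0.285; 10^2465) ≤ 12.05`).
* `ZetaArgRHExplicitCor1Proofs.lean`: **Corollary 1 (`S`) from Theorem 1 (i) and Brent–Platt–Trudgian**:
  `Literature.NumberTheory.LFunctions.Simonic2022_cor1_S_of_thm1_S :
  Simonic2022_thm1_S → BrentPlattTrudgian2022_cor1 → BrentPlattTrudgian2022_lemma1 → Simonic2022_cor1_S`.
* `ZetaArgRHExplicitCor1ZetaProofs.lean`: **Corollary 1 (`ζ`, v2) from Theorem 1 (iii) v2 and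
  Hiary–Patel–Yang**: `Literature.NumberTheory.LFunctions.Simonic2022_cor1_zeta_v2_of_thm1 :
  Simonic2022_thm1_zeta_v2 → zeta_half_line_hiary_patel_yang → Simonic2022_cor1_zeta_v2`.
* `ZetaArgRHExplicitCor1S1Proofs.lean`: **Corollary 1 (`S₁`, v2) from Theorem 1 (ii)** alone:
  `Literature.NumberTheory.LFunctions.Simonic2022_cor1_S1_v2_of_thm1_S1 :
  Simonic2022_thm1_S1 → Simonic2022_cor1_S1_v2`, the unconditional input (1.7)
  (`|S₁(t)| ≤ 0.059 log t + 3.054`, `t ≥ 1`, resting on `|S₁(168π)| ≤ 0.987`) being the tree's THEOREM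
  `Literature.NumberTheory.LFunctions.abs_zetaArgS1_le` (`ZetaArgSIntegralLowHeightNumerics.lean`,
  kernel certificate `S₁(168π) ∈ [−0.98663, −0.9866]`, computational lane).
* `ZetaZeroWindowsRHExplicit.lean`: from Corollary 1 (`S`), on RH, zeros in a window
  (`Literature.NumberTheory.LFunctions.Simonic2022_cor1_S.window_le`) and the explicit multiplicity bound
  `m(ρ) ≤ 2 log γ/log log γ` for `γ ≥ 31` (`Literature.NumberTheory.LFunctions.Simonic2022_cor1_S.multiplicity_le`,
  `Literature.NumberTheory.LFunctions.Simonic2022_thm1_S.multiplicity_le`).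
* Asymptotic companions: `ZetaArgRHExtremalBounds.lean` (Carneiro–Chandee–Milinovich 2013,
  `(¼ + o(1)) log t/log log t`), `ZetaZeroGapsRHGoldstonGonek.lean`, `ZetaShortIntervalZeroCountRH.lean`,
  `ZetaZeroMultiplicityRHGoldstonGonek.lean` (Goldston–Gonek 2007, Thm. 1 and Cor. 1 proved from it).

So the independent RH-conditional inputs of this strand are `Simonic2022_thm1_S`, `Simonic2022_thm1_S1`,
`Simonic2022_thm1_zeta_v2` (the reduction of `Simonic2022_cor1_S1_v2` to Theorem 1 (ii), which needs the
numerical value `S₁(168π)` of the source's (1.7), is `ZetaArgRHExplicitCor1S1Proofs.lean`, 2026-08-27).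

## References

* A. Simonič, J. Number Theory 231 (2022) 464–491, Thm. 1, Cor. 1, Cor. 2, eq. (1.10), Lemma 6
  (= arXiv:2010.13307v2, 13 Oct 2021; Zbl 1489.11124). [Simonic2022]
* A. Simonič, arXiv:2010.13307v1 (26 Oct 2020), the superseded first preprint version of the same
  paper (Thm. 1 (iii) with `6.361`, Cor. 1 with `2.488`, `0.95`). [Simonic2020v1]
* E. C. Titchmarsh, *The Theory of the Riemann Zeta-Function*, 2nd ed. (1986), §9.3 (`S(t)`),
  Thm. 14.13–14.14 (Littlewood's RH bounds). [Titchmarsh1986]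
-/

noncomputable section

open Real MeasureTheory intervalIntegral

namespace Literature.NumberTheory.LFunctions

/-! ## The majorant `𝓜(a, b, c; t)` -/

/-- Simonič's majorant `𝓜(a, b, c; t) := a + b/((log t)^c · log log t)` (for positive `a, b, c`;
the source's eq. (1.10), used in Theorem 1 and Corollary 2). A plain real function; `(log t)^c` is
the real power `Real.rpow`. [cite: Simonic2022, Thm. 1, eq. (1.10)] -/
def simonicM (a b c t : ℝ) : ℝ :=
  a + b / (Real.log t ^ c * Real.log (Real.log t))

/-- Unfolding lemma for `simonicM`. [cite: Simonic2022, eq. (1.10)] -/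
theorem simonicM_def (a b c t : ℝ) :
    simonicM a b c t = a + b / (Real.log t ^ c * Real.log (Real.log t)) := rfl

/-! ## Theorem 1 (RH-conditional) -/

/-- NAMED FACT, RH-CONDITIONAL (Simonič 2022, Theorem 1, first display, as printed: "Assume the
Riemann Hypothesis. … Then we have `|S(t)| ≤ 𝓜(0.759282, 20.1911, 0.285; t) log t/log log t` for
`t ≥ 10^2465`"). `S = zetaArgS` (see the module docstring for the convention at ordinates, under
which this reading is equivalent to the printed one). Users take `(h : Simonic2022_thm1_S)` and RH.
[cite: Simonic2022, Thm. 1 (S(t))] -/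
def Simonic2022_thm1_S : Prop :=
  RiemannHypothesis →
    ∀ t : ℝ, (10 : ℝ) ^ 2465 ≤ t →
      |zetaArgS t| ≤ simonicM 0.759282 20.1911 0.285 t * Real.log t / Real.log (Real.log t)

/-- NAMED FACT, RH-CONDITIONAL (Simonič 2022, Theorem 1, second display, as printed: "Assume the
Riemann Hypothesis. … `|S₁(t)| ≤ 𝓜(0.653, 60.12, 0.2705; t) log t/(log log t)²` for `t ≥ 10^208`"),
`S₁(t) = ∫₀ᵗ S(u) du`. Users take `(h : Simonic2022_thm1_S1)` and RH.
[cite: Simonic2022, Thm. 1 (S₁(t))] -/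
def Simonic2022_thm1_S1 : Prop :=
  RiemannHypothesis →
    ∀ t : ℝ, (10 : ℝ) ^ 208 ≤ t →
      |∫ u in (0 : ℝ)..t, zetaArgS u| ≤
        simonicM 0.653 60.12 0.2705 t * Real.log t / Real.log (Real.log t) ^ 2

/-- SUPERSEDED PREPRINT CLAIM (arXiv:2010.13307**v1**, Theorem 1, third display: "Assume the
Riemann Hypothesis. … `|ζ(1/2 + it)| ≤ exp(𝓜(0.5, 6.361, 0.252; t) log t/log log t)` for
`t ≥ 10^40`"). CAUTION: the refereed text (arXiv v2 = J. Number Theory 231) prints the WEAKER constant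
`6.992` in place of `6.361` — that statement is `Simonic2022_thm1_zeta_v2`, which this one implies
(`Simonic2022_thm1_zeta.imp_v2`) but which does not imply this one. Kept only because the tree is
append-only (typed 2026-08-26 from the v1 corpus text); do NOT cite it as a published theorem. Users
who took `(h : Simonic2022_thm1_zeta)` should take `(h : Simonic2022_thm1_zeta_v2)` instead.
[cite: Simonic2020v1, Thm. 1 (ζ(1/2+it)), superseded by Simonic2022 Thm. 1 (constant 6.992)] -/
def Simonic2022_thm1_zeta : Prop :=
  RiemannHypothesis →
    ∀ t : ℝ, (10 : ℝ) ^ 40 ≤ t →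
      ‖riemannZeta (1 / 2 + t * Complex.I)‖ ≤
        Real.exp (simonicM 0.5 6.361 0.252 t * Real.log t / Real.log (Real.log t))

/-- NAMED FACT, RH-CONDITIONAL (Simonič 2022, Theorem 1, third display, as printed in the refereed
text (arXiv v2, 13 Oct 2021 = J. Number Theory 231 (2022)): "Assume the Riemann Hypothesis. …
`|ζ(1/2 + it)| ≤ exp(𝓜(0.5, 6.992, 0.252; t) log t/log log t)` for `t ≥ 10^40`"). An explicit form
of Littlewood's `C₀₀` bound (Titchmarsh Thm. 14.14 (A); in the tree inexplicitly as
`CriticalLineRH.exists_norm_zeta_half_le_exp_of_RH`); the source obtains `C₀₀ = 0.373 + o(1)` by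
Soundararajan's method and `0.5` absorbs part of the explicit `o(1)`. (The first preprint version
printed `6.361`; see `Simonic2022_thm1_zeta` and the module docstring.) Users take
`(h : Simonic2022_thm1_zeta_v2)` and RH. [cite: Simonic2022, Thm. 1 (ζ(1/2+it)), arXiv v2 = journal text] -/
def Simonic2022_thm1_zeta_v2 : Prop :=
  RiemannHypothesis →
    ∀ t : ℝ, (10 : ℝ) ^ 40 ≤ t →
      ‖riemannZeta (1 / 2 + t * Complex.I)‖ ≤
        Real.exp (simonicM 0.5 6.992 0.252 t * Real.log t / Real.log (Real.log t))

/-! ## Corollary 1 (RH-conditional, all `t ≥ 2π`) -/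

/-- NAMED FACT, RH-CONDITIONAL (Simonič 2022, Corollary 1, first bound, as printed: "Assume the
Riemann Hypothesis. Then we have `|S(t)| ≤ 0.96 log t/log log t` … for `t ≥ 2π`"; obtained in the
source from Theorem 1 together with the unconditional `|S(t)| ≤ 0.11 log t + 0.29 log log t + 2.29`
(`t ≥ e`) and Brent–Platt–Trudgian's `|S(t)| ≤ 0.28 log t` (`t ≥ 2π`)). `S = zetaArgS`. Users take
`(h : Simonic2022_cor1_S)` and RH. [cite: Simonic2022, Cor. 1 (S(t))] -/
def Simonic2022_cor1_S : Prop :=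
  RiemannHypothesis →
    ∀ t : ℝ, 2 * π ≤ t → |zetaArgS t| ≤ 0.96 * Real.log t / Real.log (Real.log t)

/-- SUPERSEDED PREPRINT CLAIM (arXiv:2010.13307**v1**, Corollary 1, second bound: "Assume the
Riemann Hypothesis. Then … `|S₁(t)| ≤ 2.488 log t/(log log t)²` … for `t ≥ 2π`"). CAUTION: the
refereed text (arXiv v2 = J. Number Theory 231) prints `2.491` — that statement is
`Simonic2022_cor1_S1_v2` (implied by this one, `Simonic2022_cor1_S1.imp_v2`, not conversely). Kept
only because the tree is append-only; do NOT cite it as a published theorem.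
[cite: Simonic2020v1, Cor. 1 (S₁(t)), superseded by Simonic2022 Cor. 1 (constant 2.491)] -/
def Simonic2022_cor1_S1 : Prop :=
  RiemannHypothesis →
    ∀ t : ℝ, 2 * π ≤ t →
      |∫ u in (0 : ℝ)..t, zetaArgS u| ≤ 2.488 * Real.log t / Real.log (Real.log t) ^ 2

/-- NAMED FACT, RH-CONDITIONAL (Simonič 2022, Corollary 1, second bound, as printed in the refereed
text (arXiv v2 = J. Number Theory 231 (2022)): "Assume the Riemann Hypothesis. Then …
`|S₁(t)| ≤ 2.491 log t/(log log t)²` … for `t ≥ 2π`"; from Theorem 1 (ii) and the unconditional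
`|S₁(t)| ≤ 0.059 log t + 3.054`, `t ≥ 1` (the source's (1.7))). (The first preprint version printed
`2.488`; see `Simonic2022_cor1_S1`.) Users take `(h : Simonic2022_cor1_S1_v2)` and RH.
[cite: Simonic2022, Cor. 1 (S₁(t)), arXiv v2 = journal text] -/
def Simonic2022_cor1_S1_v2 : Prop :=
  RiemannHypothesis →
    ∀ t : ℝ, 2 * π ≤ t →
      |∫ u in (0 : ℝ)..t, zetaArgS u| ≤ 2.491 * Real.log t / Real.log (Real.log t) ^ 2

/-- SUPERSEDED PREPRINT CLAIM (arXiv:2010.13307**v1**, Corollary 1, third bound: "Assume the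
Riemann Hypothesis. Then … `|ζ(1/2 + it)| ≤ exp(0.95 log t/log log t)` for `t ≥ 2π`"). CAUTION:
the refereed text (arXiv v2 = J. Number Theory 231) prints `0.995` — that statement is
`Simonic2022_cor1_zeta_v2` (implied by this one, `Simonic2022_cor1_zeta.imp_v2`, not conversely).
Kept only because the tree is append-only; do NOT cite it as a published theorem.
[cite: Simonic2020v1, Cor. 1 (ζ(1/2+it)), superseded by Simonic2022 Cor. 1 (constant 0.995)] -/
def Simonic2022_cor1_zeta : Prop :=
  RiemannHypothesis →
    ∀ t : ℝ, 2 * π ≤ t →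
      ‖riemannZeta (1 / 2 + t * Complex.I)‖ ≤ Real.exp (0.95 * Real.log t / Real.log (Real.log t))

/-- NAMED FACT, RH-CONDITIONAL (Simonič 2022, Corollary 1, third bound, as printed in the refereed
text (arXiv v2 = J. Number Theory 231 (2022)): "Assume the Riemann Hypothesis. Then …
`|ζ(1/2 + it)| ≤ exp(0.995 log t/log log t)` for `t ≥ 2π`"; from Theorem 1 (iii) and Hiary's
`0.63 t^{1/6} log t` — the source notes the Cheng–Graham/Patel correction `0.63 → 0.77` and states
"Our results are not affected by this"). (The first preprint version printed `0.95`; see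
`Simonic2022_cor1_zeta`.) Users take `(h : Simonic2022_cor1_zeta_v2)` and RH.
[cite: Simonic2022, Cor. 1 (ζ(1/2+it)), arXiv v2 = journal text] -/
def Simonic2022_cor1_zeta_v2 : Prop :=
  RiemannHypothesis →
    ∀ t : ℝ, 2 * π ≤ t →
      ‖riemannZeta (1 / 2 + t * Complex.I)‖ ≤ Real.exp (0.995 * Real.log t / Real.log (Real.log t))

/-! ## Corollary 2 (RH-conditional gaps between consecutive zeros) -/

/-- NAMED FACT, RH-CONDITIONAL (Simonič 2022, Corollary 2, as printed: "Assume the Riemann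
Hypothesis. Then `γ' − γ ≤ 𝓜(9.55, 253.82, 0.285; γ)/log log γ`, where `γ' ≥ γ ≥ 10^2465` are the
ordinates of two consecutive nontrivial zeros of the Riemann zeta-function"). Consecutive ordinates
are `γ = zetaOrdinate n ≤ γ' = zetaOrdinate (n+1)` (enumeration with multiplicity; see the module
docstring). Users take `(h : Simonic2022_cor2)` and RH. [cite: Simonic2022, Cor. 2] -/
def Simonic2022_cor2 : Prop :=
  RiemannHypothesis →
    ∀ n : ℕ, (10 : ℝ) ^ 2465 ≤ zetaOrdinate n →
      zetaOrdinate (n + 1) - zetaOrdinate n ≤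
        simonicM 9.55 253.82 0.285 (zetaOrdinate n) / Real.log (Real.log (zetaOrdinate n))

/-- NAMED FACT, RH-CONDITIONAL (Simonič 2022, Corollary 2, last sentence, as printed: "In particular,
`γ' − γ ≤ 12.05/log log γ` for `γ' ≥ γ ≥ 10^2465`"). Users take `(h : Simonic2022_cor2_simple)` and
RH. (It follows from `Simonic2022_cor2` by `𝓜(9.55, 253.82, 0.285; 10^2465) ≤ 12.05`, a numerical
evaluation of a real power not redone here.) [cite: Simonic2022, Cor. 2 (in particular)] -/
def Simonic2022_cor2_simple : Prop :=
  RiemannHypothesis →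
    ∀ n : ℕ, (10 : ℝ) ^ 2465 ≤ zetaOrdinate n →
      zetaOrdinate (n + 1) - zetaOrdinate n ≤ 12.05 / Real.log (Real.log (zetaOrdinate n))

/-! ## Elementary consequences (proved): freezing the majorant at the threshold -/

/-- For `t ≥ 16`: `1 < log t` and `0 < log log t` (`log 16 = 4 log 2 > 2.77 > e`? we only need
`log 16 > 1`, from `log 2 > 0.6931`). [folklore] -/
private theorem one_lt_log_of_sixteen_le {t : ℝ} (ht : 16 ≤ t) : 1 < Real.log t := by
  have h2 : Real.log 16 = 4 * Real.log 2 := by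
    rw [show (16 : ℝ) = 2 ^ 4 by norm_num, Real.log_pow]; norm_num
  have hl2 := Real.log_two_gt_d9
  have h16 : 1 < Real.log 16 := by rw [h2]; linarith
  exact h16.trans_le (Real.log_le_log (by norm_num) ht)

/-- `𝓜(a, b, c; ·)` is non-increasing on `[16, ∞)` when `b, c ≥ 0`: for `16 ≤ t₀ ≤ t`,
`𝓜(a,b,c;t) ≤ 𝓜(a,b,c;t₀)` (both `(log t)^c` and `log log t` are positive and non-decreasing
there). [cite: Simonic2022, eq. (1.10)] -/
theorem simonicM_le_of_le {a b c t₀ t : ℝ} (hb : 0 ≤ b) (hc : 0 ≤ c) (h₀ : 16 ≤ t₀) (ht : t₀ ≤ t) :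
    simonicM a b c t ≤ simonicM a b c t₀ := by
  have hL₀ : 1 < Real.log t₀ := one_lt_log_of_sixteen_le h₀
  have hL : 1 < Real.log t := one_lt_log_of_sixteen_le (h₀.trans ht)
  have hLle : Real.log t₀ ≤ Real.log t := Real.log_le_log (by linarith) ht
  have hLL₀ : 0 < Real.log (Real.log t₀) := Real.log_pos hL₀
  have hLLle : Real.log (Real.log t₀) ≤ Real.log (Real.log t) :=
    Real.log_le_log (by linarith) hLle
  have hP₀ : 0 < Real.log t₀ ^ c := Real.rpow_pos_of_pos (by linarith) _
  have hPle : Real.log t₀ ^ c ≤ Real.log t ^ c :=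
    Real.rpow_le_rpow (by linarith) hLle hc
  have hD₀ : 0 < Real.log t₀ ^ c * Real.log (Real.log t₀) := mul_pos hP₀ hLL₀
  have hDle : Real.log t₀ ^ c * Real.log (Real.log t₀) ≤ Real.log t ^ c * Real.log (Real.log t) :=
    mul_le_mul hPle hLLle hLL₀.le (hP₀.le.trans hPle)
  unfold simonicM
  have := div_le_div_of_nonneg_left hb hD₀ hDle
  linarith


/-- `16 ≤ 10^n` for `n ≥ 2`. [folklore] -/
private theorem sixteen_le_ten_pow {n : ℕ} (hn : 2 ≤ n) : (16 : ℝ) ≤ 10 ^ n :=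
  le_trans (by norm_num) (pow_le_pow_right₀ (by norm_num : (1 : ℝ) ≤ 10) hn)

/-- `𝓜(a, b, c; t)` is non-decreasing in `b` for `t ≥ 16` (there `(log t)^c · log log t > 0`): if
`b ≤ b'` then `𝓜(a,b,c;t) ≤ 𝓜(a,b',c;t)`. [cite: Simonic2022, eq. (1.10)] -/
theorem simonicM_le_simonicM_of_le {a b b' c t : ℝ} (hb : b ≤ b') (ht : 16 ≤ t) :
    simonicM a b c t ≤ simonicM a b' c t := by
  have hL : 1 < Real.log t := one_lt_log_of_sixteen_le ht
  have hD : 0 < Real.log t ^ c * Real.log (Real.log t) :=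
    mul_pos (Real.rpow_pos_of_pos (by linarith) _) (Real.log_pos hL)
  unfold simonicM
  have := div_le_div_of_nonneg_right hb hD.le
  linarith

/-- `0 < log t` for `t ≥ 2π` (`2π > 6 > 1`). [folklore] -/
private theorem log_pos_of_two_pi_le {t : ℝ} (ht : 2 * π ≤ t) : 0 < Real.log t := by
  have hπ : 3 < π := Real.pi_gt_three
  exact Real.log_pos (by linarith)

namespace Simonic2022_thm1_S

/-- Frozen-constant form of Theorem 1 (i): under RH, for `t ≥ t₀ ≥ 10^2465`,
`|S(t)| ≤ 𝓜(0.759282, 20.1911, 0.285; t₀) · log t/log log t`. [cite: Simonic2022, Thm. 1 (S(t))] -/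
theorem le_const (h : Simonic2022_thm1_S) (hRH : RiemannHypothesis) {t₀ t : ℝ}
    (h₀ : (10 : ℝ) ^ 2465 ≤ t₀) (ht : t₀ ≤ t) :
    |zetaArgS t| ≤ simonicM 0.759282 20.1911 0.285 t₀ * Real.log t / Real.log (Real.log t) := by
  have h16 : (16 : ℝ) ≤ t₀ := le_trans (sixteen_le_ten_pow (by norm_num)) h₀
  have hL : 1 < Real.log t := one_lt_log_of_sixteen_le (h16.trans ht)
  have hLL : 0 < Real.log (Real.log t) := Real.log_pos hL
  have hM := simonicM_le_of_le (a := 0.759282) (by norm_num : (0 : ℝ) ≤ 20.1911)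
    (by norm_num : (0 : ℝ) ≤ 0.285) h16 ht
  refine (h hRH t (h₀.trans ht)).trans ?_
  rw [mul_div_assoc, mul_div_assoc]
  exact mul_le_mul_of_nonneg_right hM (div_nonneg (by linarith) hLL.le)

end Simonic2022_thm1_S

namespace Simonic2022_thm1_S1

/-- Frozen-constant form of Theorem 1 (ii): under RH, for `t ≥ t₀ ≥ 10^208`,
`|S₁(t)| ≤ 𝓜(0.653, 60.12, 0.2705; t₀) · log t/(log log t)²`. [cite: Simonic2022, Thm. 1 (S₁(t))] -/
theorem le_const (h : Simonic2022_thm1_S1) (hRH : RiemannHypothesis) {t₀ t : ℝ}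
    (h₀ : (10 : ℝ) ^ 208 ≤ t₀) (ht : t₀ ≤ t) :
    |∫ u in (0 : ℝ)..t, zetaArgS u| ≤
      simonicM 0.653 60.12 0.2705 t₀ * Real.log t / Real.log (Real.log t) ^ 2 := by
  have h16 : (16 : ℝ) ≤ t₀ := le_trans (sixteen_le_ten_pow (by norm_num)) h₀
  have hL : 1 < Real.log t := one_lt_log_of_sixteen_le (h16.trans ht)
  have hLL : 0 < Real.log (Real.log t) := Real.log_pos hL
  have hM := simonicM_le_of_le (a := 0.653) (by norm_num : (0 : ℝ) ≤ 60.12)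
    (by norm_num : (0 : ℝ) ≤ 0.2705) h16 ht
  refine (h hRH t (h₀.trans ht)).trans ?_
  rw [mul_div_assoc, mul_div_assoc]
  exact mul_le_mul_of_nonneg_right hM (div_nonneg (by linarith) (by positivity))

end Simonic2022_thm1_S1

namespace Simonic2022_thm1_zeta

/-- Frozen-constant form of Theorem 1 (iii): under RH, for `t ≥ t₀ ≥ 10^40`,
`|ζ(½ + it)| ≤ exp(𝓜(0.5, 6.361, 0.252; t₀) · log t/log log t)`. [cite: Simonic2022, Thm. 1 (ζ(1/2+it))] -/
theorem le_const (h : Simonic2022_thm1_zeta) (hRH : RiemannHypothesis) {t₀ t : ℝ}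
    (h₀ : (10 : ℝ) ^ 40 ≤ t₀) (ht : t₀ ≤ t) :
    ‖riemannZeta (1 / 2 + t * Complex.I)‖ ≤
      Real.exp (simonicM 0.5 6.361 0.252 t₀ * Real.log t / Real.log (Real.log t)) := by
  have h16 : (16 : ℝ) ≤ t₀ := le_trans (sixteen_le_ten_pow (by norm_num)) h₀
  have hL : 1 < Real.log t := one_lt_log_of_sixteen_le (h16.trans ht)
  have hLL : 0 < Real.log (Real.log t) := Real.log_pos hL
  have hM := simonicM_le_of_le (a := 0.5) (by norm_num : (0 : ℝ) ≤ 6.361)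
    (by norm_num : (0 : ℝ) ≤ 0.252) h16 ht
  refine (h hRH t (h₀.trans ht)).trans (Real.exp_le_exp.2 ?_)
  rw [mul_div_assoc, mul_div_assoc]
  exact mul_le_mul_of_nonneg_right hM (div_nonneg (by linarith) hLL.le)

/-- v1 ⇒ v2: the superseded preprint constant `6.361` trivially implies the refereed `6.992`
(`𝓜` is monotone in `b`, `exp` is monotone). [cite: Simonic2022, Thm. 1 (ζ(1/2+it))] -/
theorem imp_v2 (h : Simonic2022_thm1_zeta) : Simonic2022_thm1_zeta_v2 := by
  intro hRH t ht
  have h16 : (16 : ℝ) ≤ t := le_trans (sixteen_le_ten_pow (by norm_num)) ht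
  have hL : 1 < Real.log t := one_lt_log_of_sixteen_le h16
  have hLL : 0 < Real.log (Real.log t) := Real.log_pos hL
  have hM := simonicM_le_simonicM_of_le (a := 0.5) (c := 0.252) (by norm_num : (6.361 : ℝ) ≤ 6.992) h16
  refine (h hRH t ht).trans (Real.exp_le_exp.2 ?_)
  rw [mul_div_assoc, mul_div_assoc]
  exact mul_le_mul_of_nonneg_right hM (div_nonneg (by linarith) hLL.le)

end Simonic2022_thm1_zeta

namespace Simonic2022_thm1_zeta_v2

/-- Frozen-constant form of Theorem 1 (iii) (refereed constant): under RH, for `t ≥ t₀ ≥ 10^40`,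
`|ζ(½ + it)| ≤ exp(𝓜(0.5, 6.992, 0.252; t₀) · log t/log log t)`.
[cite: Simonic2022, Thm. 1 (ζ(1/2+it))] -/
theorem le_const (h : Simonic2022_thm1_zeta_v2) (hRH : RiemannHypothesis) {t₀ t : ℝ}
    (h₀ : (10 : ℝ) ^ 40 ≤ t₀) (ht : t₀ ≤ t) :
    ‖riemannZeta (1 / 2 + t * Complex.I)‖ ≤
      Real.exp (simonicM 0.5 6.992 0.252 t₀ * Real.log t / Real.log (Real.log t)) := by
  have h16 : (16 : ℝ) ≤ t₀ := le_trans (sixteen_le_ten_pow (by norm_num)) h₀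
  have hL : 1 < Real.log t := one_lt_log_of_sixteen_le (h16.trans ht)
  have hLL : 0 < Real.log (Real.log t) := Real.log_pos hL
  have hM := simonicM_le_of_le (a := 0.5) (by norm_num : (0 : ℝ) ≤ 6.992)
    (by norm_num : (0 : ℝ) ≤ 0.252) h16 ht
  refine (h hRH t (h₀.trans ht)).trans (Real.exp_le_exp.2 ?_)
  rw [mul_div_assoc, mul_div_assoc]
  exact mul_le_mul_of_nonneg_right hM (div_nonneg (by linarith) hLL.le)

end Simonic2022_thm1_zeta_v2

namespace Simonic2022_cor1_S1

/-- v1 ⇒ v2: `2.488 ≤ 2.491`. [cite: Simonic2022, Cor. 1 (S₁(t))] -/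
theorem imp_v2 (h : Simonic2022_cor1_S1) : Simonic2022_cor1_S1_v2 := by
  intro hRH t ht
  have hL : 0 < Real.log t := log_pos_of_two_pi_le ht
  refine (h hRH t ht).trans ?_
  rw [mul_div_assoc, mul_div_assoc]
  exact mul_le_mul_of_nonneg_right (by norm_num) (div_nonneg hL.le (sq_nonneg _))

end Simonic2022_cor1_S1

namespace Simonic2022_cor1_zeta

/-- v1 ⇒ v2: `0.95 ≤ 0.995`, and `log t/log log t > 0` on the whole range `t ≥ 2π > e`.
[cite: Simonic2022, Cor. 1 (ζ(1/2+it))] -/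
theorem imp_v2 (h : Simonic2022_cor1_zeta) : Simonic2022_cor1_zeta_v2 := by
  intro hRH t ht
  have hπ : 3 < π := Real.pi_gt_three
  have he : Real.exp 1 < t := lt_of_lt_of_le (by have := Real.exp_one_lt_d9; linarith) ht
  have hL : 1 < Real.log t := by
    rw [← Real.exp_lt_exp, Real.exp_log (by linarith)]; exact he
  have hLL : 0 < Real.log (Real.log t) := Real.log_pos hL
  refine (h hRH t ht).trans (Real.exp_le_exp.2 ?_)
  rw [mul_div_assoc, mul_div_assoc]
  exact mul_le_mul_of_nonneg_right (by norm_num) (div_nonneg (by linarith) hLL.le)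

end Simonic2022_cor1_zeta

namespace Simonic2022_cor2

/-- Frozen-constant form of Corollary 2: under RH, consecutive ordinates `γ' ≥ γ ≥ t₀ ≥ 10^2465`
satisfy `γ' − γ ≤ 𝓜(9.55, 253.82, 0.285; t₀)/log log γ`. [cite: Simonic2022, Cor. 2] -/
theorem le_const (h : Simonic2022_cor2) (hRH : RiemannHypothesis) {t₀ : ℝ} {n : ℕ}
    (h₀ : (10 : ℝ) ^ 2465 ≤ t₀) (hn : t₀ ≤ zetaOrdinate n) :
    zetaOrdinate (n + 1) - zetaOrdinate n ≤
      simonicM 9.55 253.82 0.285 t₀ / Real.log (Real.log (zetaOrdinate n)) := by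
  have h16 : (16 : ℝ) ≤ t₀ := le_trans (sixteen_le_ten_pow (by norm_num)) h₀
  have hL : 1 < Real.log (zetaOrdinate n) := one_lt_log_of_sixteen_le (h16.trans hn)
  have hLL : 0 < Real.log (Real.log (zetaOrdinate n)) := Real.log_pos hL
  have hM := simonicM_le_of_le (a := 9.55) (by norm_num : (0 : ℝ) ≤ 253.82)
    (by norm_num : (0 : ℝ) ≤ 0.285) h16 hn
  exact (h hRH n (h₀.trans hn)).trans (div_le_div_of_nonneg_right hM hLL.le)

end Simonic2022_cor2

end Literature.NumberTheory.LFunctions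

end
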